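import Summits.Ventures.HodgeRepro2.Orientation
import Summits.Ventures.HodgeRepro2.SexticGalois
import Summits.Ventures.HodgeRepro2.T6B4Main

/-!
# T6B4Robust — CLAIM (B4-III) «the convention only relabels», on the B4_main side (Tier 6, sub-goal B4)

Cell pub-hodge-repro2, owner t6-p7 (route/T6-B4-t6-p7.md). TIER4 Prop. B4.5 is kernel-checked by
p1 at the level of CM types (CubeCoordinates / Orientation / SexticGalois: inversion fixes each parity
tetrahedron, conjugation exchanges the two). This file records what that means THROUGH `B4_main`:
* `isCMType_inducedSet`, `isCMType_of_hodgeDictionary` — the type induced from a CM type is a CM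
  type, so `Φ̃(τ₁)` is a CM type of `M̃_μ` (the «Φ̃ is a CM type» clause of (Eq), derived, not assumed);
* `B4_conjugateDictionary` — Prop. B4.5(c1): with the CONJUGATE dictionary (`Φ_μ ↦ Φ̄_μ = Φ_{μ^c}`)
  `Φ̃(τ₁)` is induced from `(F₁, conj (Φ_μ⁻¹))`: the same embeddings, the `F`-action composed with
  complex conjugation — for `Φ_μ = T_i⁻¹` the vertex `T̄_i` of the even tetrahedron;
* `B4_droppedInversion` — Prop. B4.5(c2): with `Φ_{μ_i} = T_i` (no inversion) the threefold has type
  `T_i⁻¹ = T_j`, another vertex of the same tetrahedron (`exists_inverseType_parityTetrahedron_eq`).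
Proof lane: 0 sorry; axioms ⊆ {propext, Classical.choice, Quot.sound}.
§8(d): uses an L-value-free non-vanishing device: NO.
-/

namespace Summit.Ventures.HodgeRepro2.T6.B4Robust

open Summit.Ventures.HodgeRepro2 Summit.Ventures.HodgeRepro2.T6.B4Interface
  Summit.Ventures.HodgeRepro2.T6.B4Main

variable {K : Type*} [Field K]

/-- Restriction to `K` commutes with complex conjugation of embeddings. -/
theorem conjugate_comp_algebraMap {M : IntermediateField ℚ ℂ} [Algebra K M] (θ : M →+* ℂ) :
    (NumberField.ComplexEmbedding.conjugate θ).comp (algebraMap K M) =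
      NumberField.ComplexEmbedding.conjugate (θ.comp (algebraMap K M)) := by
  ext x
  simp [NumberField.ComplexEmbedding.conjugate_coe_eq]

/-- **The type induced from a CM type is a CM type**: if `T` is a CM type of `K` then
`inducedSet T = {θ : θ|_K ∈ T}` is a CM type of `M` (the «Φ̃ is a CM type» clause of (Eq) / the
induced CM type of Lemma B4.4). -/
theorem isCMType_inducedSet (M : IntermediateField ℚ ℂ) [Algebra K M] {T : Set (K →+* ℂ)}
    (hT : IsCMType K T) : IsCMType M (inducedSet (K := K) (L := M) T) := by
  intro θ
  rw [mem_inducedSet_iff, mem_inducedSet_iff, conjugate_comp_algebraMap]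
  exact hT (θ.comp (algebraMap K M))

/-- Under (Eq), (D) and `F₁ ⊆ M̃_μ`, `Φ̃(τ₁)` is a CM type of `M̃_μ` as soon as `Φ_μ` is a CM type
of `F` (`B4_main` + `isCMType_inverseType` + `isCMType_inducedSet`). -/
theorem isCMType_of_hodgeDictionary [NumberField K] [NumberField.IsCMField K] [IsGalois ℚ K]
    (τ₁ : K →+* ℂ) {Φμ : Set (K →+* ℂ)} (hΦ : IsCMType K Φμ)
    (M : IntermediateField ℚ ℂ) [FiniteDimensional ℚ M] [Algebra K M]
    (hτ : (algebraMap M ℂ).comp (algebraMap K M) = τ₁)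
    (Φt : (K →+* ℂ) → Set (M →+* ℂ)) (hEq : EqCompat M Φt) (hD : HodgeDictionary M Φμ Φt) :
    IsCMType M (Φt τ₁) := by
  have h := B4_main τ₁ Φμ M hτ Φt hEq hD
  unfold InverseTypeForced at h
  rw [h]
  exact isCMType_inducedSet M (isCMType_inverseType K τ₁ hΦ)

/-- **Prop. B4.5(c1), the conjugate dictionary**: if (D) is replaced by its conjugate — `Φ_μ`
replaced by `Φ̄_μ = Φ_{μ^c}` — then `Φ̃(τ₁)` is the type induced from `(F₁, conj (Φ_μ⁻¹))`: the
same `M̃_μ`-embeddings with the `F`-action composed with complex conjugation (`inverseType_conjCMType`).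
For `Φ_μ = T_i⁻¹` this is the vertex `T̄_i` of the EVEN tetrahedron
(`evenTetrahedron_eq_conjCMType`). -/
theorem B4_conjugateDictionary [NumberField K] [NumberField.IsCMField K] [IsGalois ℚ K]
    (τ₁ : K →+* ℂ) (Φμ : Set (K →+* ℂ)) (M : IntermediateField ℚ ℂ) [FiniteDimensional ℚ M]
    [Algebra K M] (hτ : (algebraMap M ℂ).comp (algebraMap K M) = τ₁)
    (Φt : (K →+* ℂ) → Set (M →+* ℂ)) (hEq : EqCompat M Φt)
    (hD : HodgeDictionary M (conjCMType K Φμ) Φt) :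
    Φt τ₁ = inducedSet (conjCMType K (inverseType K τ₁ Φμ)) := by
  have h := B4_main τ₁ _ M hτ Φt hEq hD
  unfold InverseTypeForced at h
  rw [h, inverseType_conjCMType]

/-- **Prop. B4.5(c2), dropping the inversion**: if one took `Φ_{μ_i} = T_i` instead of `T_i⁻¹`, the
threefold obtained would have type `T_i⁻¹`, which is again a vertex `T_j` of the SAME parity
tetrahedron (`exists_inverseType_parityTetrahedron_eq`): the factors of `B` are permuted, nothing
else changes. -/
theorem B4_droppedInversion [NumberField K] [NumberField.IsCMField K] [IsGalois ℚ K]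
    (h6 : Module.finrank ℚ K = 6) (τ₁ : K →+* ℂ) (τ : Fin 3 → (K →+* ℂ))
    (hτ : IsCMType K (Set.range τ)) (i : Fin 4)
    (M : IntermediateField ℚ ℂ) [FiniteDimensional ℚ M] [Algebra K M]
    (hτ₁ : (algebraMap M ℂ).comp (algebraMap K M) = τ₁)
    (Φt : (K →+* ℂ) → Set (M →+* ℂ)) (hEq : EqCompat M Φt)
    (hD : HodgeDictionary M (parityTetrahedron K τ i) Φt) :
    ∃ j : Fin 4, Φt τ₁ = inducedSet (parityTetrahedron K τ j) := by
  obtain ⟨j, hj⟩ := exists_inverseType_parityTetrahedron_eq h6 τ₁ τ hτ i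
  refine ⟨j, ?_⟩
  have h := B4_main τ₁ _ M hτ₁ Φt hEq hD
  unfold InverseTypeForced at h
  rw [h, hj]

end Summit.Ventures.HodgeRepro2.T6.B4Robust
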